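import Summits.RiemannHypothesis.RiemannHypothesis.Theorems.WeilGroundStateGroundStatesConvergeToXiOverlapEnergy
import Summits.RiemannHypothesis.RiemannHypothesis.Theorems.WeilGroundStateGroundStatesConvergeToXiEnergyUpper
import Summits.RiemannHypothesis.RiemannHypothesis.Theorems.WeilGroundStateGroundStatesConvergeToXiLineExact
import Summits.RiemannHypothesis.RiemannHypothesis.Theorems.WeilGroundStateGroundStatesConvergeToXiPhiTail
import Summits.RiemannHypothesis.RiemannHypothesis.Theorems.GroundStatesConvergeToXi.Negative.ConvergenceClauseNonVacuous
import Summits.RiemannHypothesis.RiemannHypothesis.Theorems.GronwallLeakage.Negative.LoadBearing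
import HarnessLib

/-!
# `WeilGroundState.GroundStatesConvergeToXi` — C⁺ ⇒ RH; tightness at `b = 0` is the RH threshold
(crux item stmt-RiemannHypothesis-1527, route route-RiemannHypothesis-WeilGroundState; line `Sketch`,
lead c2; `--supports`: hardness of the open stub `stub_tightWeakLimit`, now unconditional)

From the overlap–energy inequality (`…OverlapEnergy`) and the double-exponential decay of
Riemann's kernel:

* `riemannHypothesis_of_overlap_nondegenerate` — ground states `u_k` at windows `a_k → ∞`, scalars
  `c_k` with `∫‖c_k u_k‖ ≤ M` and overlaps `‖c_k⟨u_k, φ_{a_k}⟩‖ ≥ L > 0` eventually ⇒ RH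
  (`|ε(a_k)| ≤ K M e^{a_k/2} exp(−(π/4)e^{2(a_k−1)})/L → 0`, `ε` antitone ⇒ bounded below ⇒ RH).
* `tendsto_integral_mul_phiCut_of_weak` — bounded renormalised `L¹` mass + weak convergence to
  `Φ` ⇒ `∫ c_k u_k φ_{a_k} → ‖Φ‖₂² > 0`.
* `riemannHypothesis_of_tightZero_weakLimit` — **tightness at `b = 0` + weak convergence to `Φ` ⇒ RH**.
* `riemannHypothesis_of_tightWeakLimit` — **C⁺ (the line's open stub, verbatim) ⇒ RH**.
* `riemannHypothesis_of_cruxWitness_integral_norm_le`,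
  `riemannHypothesis_of_groundStatesConvergeToXi_integral_norm_le` — **a witness of the CRUX with
  bounded renormalised `L¹` mass `∫‖c_k u_k‖ ≤ M` proves RH**; `integral_norm_unbounded_of_not_riemannHypothesis`
  — under `¬RH` every witness of the crux has unbounded renormalised `L¹` mass;
* `riemannHypothesis_of_nonneg_cruxWitness` — **a non-negative (Perron–Frobenius-shaped) witness of
  the crux proves RH** (no window-density condition).

These supersede the thresholds `b₀ > 1/2` (`…RHofTight`), `b₀ = 1/2` (`…RHofHalfTight`) and the
geometric-window condition (`…RHofTightGeo`, `…TightGeoEnergy`): the probe `φ_{a_k}` is the window's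
own truncated kernel, whose transform at the zeros is double-exponentially small, which beats the
`e^{a/2}` price of passing from `L¹` to `L¹(e^{|t|/2})` on the window; and the conclusion is
`ε(a_k) → 0` (not merely a sub-exponential lower bound), so sparse windows are harmless.
No new definitions.
-/

noncomputable section

set_option linter.dupNamespace false

open scoped Topology Real ComplexConjugate
open Filter Set MeasureTheory Complex

namespace Summit.RiemannHypothesis.RiemannHypothesis.Theorems.GroundStatesConvergeToXi

open Literature.NumberTheory.LFunctions

/-! ## RH from a non-degenerate overlap with Riemann's kernel at renormalised `L¹`-bounded windows -/

/-- **RH from a non-degenerate overlap (RH-free mechanism).**  Let `a_k → ∞`, `u_k` ground states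
at the windows `a_k`, and `c_k` scalars with `∫‖c_k u_k‖ ≤ M` (bounded renormalised `L¹` mass) and
overlaps `‖c_k ∫ u_k conj φ_{a_k}‖ ≥ L > 0` eventually.  Then RH holds: the window form of the
overlap–energy inequality gives `|ε(a_k)| L ≤ K M e^{a_k/2} exp(−(π/4)e^{2(a_k−1)}) → 0`, so
`ε(a_k) → 0`; since `ε` is non-increasing on `(0,∞)` it is bounded below, and
`riemannHypothesis_of_weilGroundEnergy_bddBelow` concludes. [folklore] -/
theorem riemannHypothesis_of_overlap_nondegenerate {a : ℕ → ℝ} {u : ℕ → ℝ → ℂ} {c : ℕ → ℂ}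
    (ha : Tendsto a atTop atTop) (hu : ∀ k, IsWeilGroundState (a k) (u k))
    (hM : ∃ M : ℝ, ∀ k, ∫ t, ‖c k * u k t‖ ≤ M)
    (hL : ∃ L : ℝ, 0 < L ∧ ∀ᶠ k in atTop, L ≤ ‖c k * ∫ t, u k t *
      conj ((2 : ℂ) * LagariasMontague.Psic (2 * t) * ((Literature.Analysis.Calculus.cutoff (a k) t : ℝ) : ℂ))‖) :
    RiemannHypothesis := by
  obtain ⟨K, hK, hO⟩ := exists_abs_weilGroundEnergy_mul_norm_overlap_le_window
  obtain ⟨M, hM⟩ := hM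
  obtain ⟨L, hL0, hLev⟩ := hL
  have hM0 : 0 ≤ M := (integral_nonneg fun _ => norm_nonneg _).trans (hM 0)
  -- `|ε(a_k)| ≤ K M η(a_k) e^{a_k/2} / L` eventually, and the right side tends to `0`
  have hbound : ∀ᶠ k in atTop, |weilGroundEnergy (a k)| ≤
      K * M / L * (Real.exp (-(π / 4 * Real.exp (2 * (a k - 1)))) * Real.exp (a k / 2)) := by
    filter_upwards [hLev, ha.eventually (eventually_ge_atTop (1 : ℝ))] with k hk hak
    have h := hO (a k) hak (u k) (hu k) (c k)
    have h1 : |weilGroundEnergy (a k)| * L ≤ K * Real.exp (-(π / 4 * Real.exp (2 * (a k - 1)))) *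
        Real.exp (a k / 2) * M :=
      (mul_le_mul_of_nonneg_left hk (abs_nonneg _)).trans (h.trans
        (mul_le_mul_of_nonneg_left (hM k) (by positivity)))
    rw [← le_div_iff₀ hL0] at h1
    refine h1.trans (le_of_eq ?_)
    field_simp
  have hzero : Tendsto (fun k => K * M / L * (Real.exp (-(π / 4 * Real.exp (2 * (a k - 1)))) *
      Real.exp (a k / 2))) atTop (𝓝 0) := by
    simpa using (tendsto_exp_half_mul_superexp_zero.comp ha).const_mul (K * M / L)
  have hev : ∀ᶠ k in atTop, -1 ≤ weilGroundEnergy (a k) := by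
    filter_upwards [hbound, hzero.eventually (ge_mem_nhds (show (0 : ℝ) < 1 by norm_num))] with k h1 h2
    have := (abs_le.1 (h1.trans h2)).1
    linarith
  obtain ⟨k₀, hk₀⟩ := hev.exists_forall_of_atTop
  refine riemannHypothesis_of_weilGroundEnergy_bddBelow ⟨-1, fun b hb => ?_⟩
  obtain ⟨k, hk⟩ := ((ha.eventually (eventually_ge_atTop b)).and (eventually_ge_atTop k₀)).exists
  exact (hk₀ k hk.2).trans
    (Summit.RiemannHypothesis.Cruxes.GronwallLeakage.Negative.weilGroundEnergy_antitone_of_pos hb hk.1)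

/-! ## Weak convergence to `Φ` makes the overlap non-degenerate -/

/-- **Weak convergence to `Φ` + bounded renormalised `L¹` mass ⇒ the overlaps with the window's own
truncated kernel converge to `‖Φ‖₂²`:** `∫ c_k u_k φ_{a_k} → ∫ Φ²` (three-epsilon argument: test
against the FIXED `φ_A`, and the tails `|φ_{a_k} − φ_A|, |φ_A − Φ| ≤ sup_{|t| ≥ A−1}|Φ| → 0`). [folklore] -/
theorem tendsto_integral_mul_phiCut_of_weak {a : ℕ → ℝ} {u : ℕ → ℝ → ℂ} {c : ℕ → ℂ}
    (ha : Tendsto a atTop atTop) (hu : ∀ k, IsWeilGroundState (a k) (u k))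
    (hM : ∃ M : ℝ, ∀ k, ∫ t, ‖c k * u k t‖ ≤ M)
    (hweak : ∀ g : ℝ → ℂ, IsWeilTest g →
      Tendsto (fun k => ∫ t, c k * u k t * g t) atTop (𝓝 (∫ t, 2 * LagariasMontague.Psic (2 * t) * g t))) :
    Tendsto (fun k => ∫ t, c k * u k t * ((2 : ℂ) * LagariasMontague.Psic (2 * t) *
        ((Literature.Analysis.Calculus.cutoff (a k) t : ℝ) : ℂ))) atTop
      (𝓝 (∫ t, ((2 : ℂ) * LagariasMontague.Psic (2 * t)) * ((2 : ℂ) * LagariasMontague.Psic (2 * t)))) := by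
  obtain ⟨M, hM⟩ := hM
  obtain ⟨K₀, hK₀, hΦ⟩ := exists_norm_phi_le
  set Φ : ℝ → ℂ := fun t => (2 : ℂ) * LagariasMontague.Psic (2 * t) with hΦdef
  set φ : ℝ → ℝ → ℂ := fun A t => (2 : ℂ) * LagariasMontague.Psic (2 * t) *
    ((Literature.Analysis.Calculus.cutoff A t : ℝ) : ℂ) with hφdef
  set δ : ℝ → ℝ := fun A => K₀ * Real.exp ((A - 1) / 2 - π / 4 * Real.exp (2 * (A - 1))) with hδdef
  have hM0 : 0 ≤ M := (integral_nonneg fun _ => norm_nonneg _).trans (hM 0)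
  -- tails of `Φ` beyond `A - 1`
  have htailΦ : ∀ A t : ℝ, 1 ≤ A → A - 1 ≤ |t| → ‖Φ t‖ ≤ δ A := by
    intro A t hA ht
    refine (hΦ t).trans (mul_le_mul_of_nonneg_left ?_ hK₀)
    have := envelope_antitone (x := |t|) (y := A - 1) (by linarith) ht
    simpa [mul_comm] using this
  have hδ0 : Tendsto δ atTop (𝓝 0) := by
    have h1 : Tendsto (fun A : ℝ => (A - 1) / 2 - π / 4 * Real.exp (2 * (A - 1))) atTop atBot := by
      have h2 : Tendsto (fun A : ℝ => π / 4 * Real.exp (2 * (A - 1)) - (A - 1) / 2) atTop atTop := by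
        have h3 : Tendsto (fun A : ℝ => (π / 2 - 1 / 2) * A + (1 / 2 - π / 4)) atTop atTop :=
          tendsto_atTop_add_const_right _ _ (tendsto_id.const_mul_atTop (by linarith [Real.pi_gt_three]))
        refine tendsto_atTop_mono (fun A => ?_) h3
        have := Real.add_one_le_exp (2 * (A - 1))
        nlinarith [Real.pi_gt_three]
      have := tendsto_neg_atTop_atBot.comp h2
      refine this.congr fun A => ?_
      simp only [Function.comp_apply]; ring
    simpa [hδdef] using (Real.tendsto_exp_atBot.comp h1).const_mul K₀
  -- differences of truncations
  have hdiff : ∀ A B t : ℝ, 1 ≤ A → A ≤ B → ‖φ B t - φ A t‖ ≤ δ A := by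
    intro A B t hA hAB
    have hδA : 0 ≤ δ A := by positivity
    by_cases ht : |t| ≤ A - 1
    · rw [hφdef]
      simp only
      rw [Literature.Analysis.Calculus.cutoff_eq_one ht,
        Literature.Analysis.Calculus.cutoff_eq_one (ht.trans (by linarith)), sub_self, norm_zero]
      exact hδA
    · have h1 : ‖φ B t - φ A t‖ ≤ ‖Φ t‖ := by
        rw [hφdef]
        simp only
        rw [← mul_sub, norm_mul, ← Complex.ofReal_sub, Complex.norm_real, Real.norm_eq_abs]
        refine mul_le_of_le_one_right (norm_nonneg _) (abs_sub_le_iff.2 ⟨?_, ?_⟩) <;>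
          linarith [Literature.Analysis.Calculus.cutoff_nonneg B t, Literature.Analysis.Calculus.cutoff_le_one B t,
            Literature.Analysis.Calculus.cutoff_nonneg A t, Literature.Analysis.Calculus.cutoff_le_one A t]
      exact h1.trans (htailΦ A t hA (not_le.1 ht).le)
  have hdiffΦ : ∀ A t : ℝ, 1 ≤ A → ‖Φ t - φ A t‖ ≤ δ A := by
    intro A t hA
    have hδA : 0 ≤ δ A := by positivity
    by_cases ht : |t| ≤ A - 1
    · rw [hφdef]
      simp only
      rw [Literature.Analysis.Calculus.cutoff_eq_one ht]
      simp [hΦdef, hδA]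
    · have h1 : ‖Φ t - φ A t‖ ≤ ‖Φ t‖ := by
        rw [hφdef, hΦdef]
        simp only
        rw [show (2 : ℂ) * LagariasMontague.Psic (2 * t) - 2 * LagariasMontague.Psic (2 * t) *
            ((Literature.Analysis.Calculus.cutoff A t : ℝ) : ℂ) =
            2 * LagariasMontague.Psic (2 * t) * ((1 - Literature.Analysis.Calculus.cutoff A t : ℝ) : ℂ) by
            push_cast; ring, norm_mul, Complex.norm_real, Real.norm_eq_abs]
        refine mul_le_of_le_one_right (norm_nonneg _) (abs_le.2 ⟨?_, ?_⟩) <;>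
          linarith [Literature.Analysis.Calculus.cutoff_nonneg A t, Literature.Analysis.Calculus.cutoff_le_one A t]
      exact h1.trans (htailΦ A t hA (not_le.1 ht).le)
  -- integrability facts
  have hint_cu : ∀ k (A : ℝ), Integrable fun t => c k * u k t * φ A t := by
    intro k A
    have h := ((hu k).integrable_mul_continuous (isWeilTest_phiCut A).1.continuous).const_mul (c k)
    refine h.congr (ae_of_all _ fun t => ?_)
    simp only [hφdef]; ring
  have hint_Φφ : ∀ A : ℝ, Integrable fun t => Φ t * φ A t := fun A =>
    ((continuous_phi.mul (isWeilTest_phiCut A).1.continuous).integrable_of_hasCompactSupport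
      (isWeilTest_phiCut A).2.mul_left)
  have hint_ΦΦ : Integrable fun t => Φ t * Φ t := Negative.memLp_phi.integrable_mul Negative.memLp_phi
  have hIΦ : 0 ≤ ∫ t, ‖Φ t‖ := integral_nonneg fun _ => norm_nonneg _
  -- the three-epsilon argument
  rw [Metric.tendsto_atTop]
  intro ε hε
  obtain ⟨A, hA1, hAδ⟩ := ((eventually_ge_atTop (1 : ℝ)).and
    (hδ0.eventually (gt_mem_nhds (show (0 : ℝ) < ε / (2 * (M + (∫ t, ‖Φ t‖) + 1)) by
      positivity)))).exists
  have hweakA := Metric.tendsto_atTop.1 (hweak (φ A) (isWeilTest_phiCut A)) (ε / 2) (by positivity)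
  obtain ⟨N₁, hN₁⟩ := hweakA
  obtain ⟨N₂, hN₂⟩ := (ha.eventually (eventually_ge_atTop A)).exists_forall_of_atTop
  refine ⟨max N₁ N₂, fun k hk => ?_⟩
  have hk1 := hN₁ k ((le_max_left _ _).trans hk)
  have hk2 : A ≤ a k := hN₂ k ((le_max_right _ _).trans hk)
  rw [dist_eq_norm] at hk1 ⊢
  have hδA : 0 ≤ δ A := by positivity
  -- split the difference
  have e1 : (∫ t, c k * u k t * φ (a k) t) - ∫ t, Φ t * Φ t =
      ((∫ t, c k * u k t * φ A t) - ∫ t, Φ t * φ A t) +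
      (∫ t, c k * u k t * (φ (a k) t - φ A t)) + ∫ t, Φ t * (φ A t - Φ t) := by
    have i1 : ∫ t, c k * u k t * (φ (a k) t - φ A t) =
        (∫ t, c k * u k t * φ (a k) t) - ∫ t, c k * u k t * φ A t := by
      rw [← integral_sub (hint_cu k (a k)) (hint_cu k A)]
      exact integral_congr_ae (ae_of_all _ fun t => by ring)
    have i2 : ∫ t, Φ t * (φ A t - Φ t) = (∫ t, Φ t * φ A t) - ∫ t, Φ t * Φ t := by
      rw [← integral_sub (hint_Φφ A) hint_ΦΦ]
      exact integral_congr_ae (ae_of_all _ fun t => by ring)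
    rw [i1, i2]; ring
  have b2 : ‖∫ t, c k * u k t * (φ (a k) t - φ A t)‖ ≤ δ A * M := by
    calc ‖∫ t, c k * u k t * (φ (a k) t - φ A t)‖ ≤ ∫ t, ‖c k * u k t * (φ (a k) t - φ A t)‖ :=
          norm_integral_le_integral_norm _
      _ ≤ ∫ t, δ A * ‖c k * u k t‖ := by
          refine integral_mono_of_nonneg (ae_of_all _ fun _ => norm_nonneg _)
            ((stub_pointwise_of_weak_integrable_weight (hu k) (c k) 0 |>.congr
              (ae_of_all _ fun t => by simp)).const_mul _) (ae_of_all _ fun t => ?_)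
          show ‖c k * u k t * (φ (a k) t - φ A t)‖ ≤ δ A * ‖c k * u k t‖
          rw [norm_mul, mul_comm]
          exact mul_le_mul_of_nonneg_right (hdiff A (a k) t hA1 hk2) (norm_nonneg _)
      _ = δ A * ∫ t, ‖c k * u k t‖ := integral_const_mul _ _
      _ ≤ δ A * M := mul_le_mul_of_nonneg_left (hM k) hδA
  have b3 : ‖∫ t, Φ t * (φ A t - Φ t)‖ ≤ δ A * ∫ t, ‖Φ t‖ := by
    calc ‖∫ t, Φ t * (φ A t - Φ t)‖ ≤ ∫ t, ‖Φ t * (φ A t - Φ t)‖ := norm_integral_le_integral_norm _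
      _ ≤ ∫ t, δ A * ‖Φ t‖ := by
          refine integral_mono_of_nonneg (ae_of_all _ fun _ => norm_nonneg _)
            (Negative.integrable_phi.norm.const_mul _) (ae_of_all _ fun t => ?_)
          show ‖Φ t * (φ A t - Φ t)‖ ≤ δ A * ‖Φ t‖
          rw [norm_mul, mul_comm, norm_sub_rev]
          exact mul_le_mul_of_nonneg_right (hdiffΦ A t hA1) (norm_nonneg _)
      _ = δ A * ∫ t, ‖Φ t‖ := integral_const_mul _ _
  have hsmall : δ A * (M + (∫ t, ‖Φ t‖) + 1) < ε / 2 := by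
    have h := hAδ
    rw [lt_div_iff₀ (by positivity)] at h
    linarith
  calc ‖(∫ t, c k * u k t * φ (a k) t) - ∫ t, Φ t * Φ t‖
      ≤ ‖(∫ t, c k * u k t * φ A t) - ∫ t, Φ t * φ A t‖ +
        ‖∫ t, c k * u k t * (φ (a k) t - φ A t)‖ + ‖∫ t, Φ t * (φ A t - Φ t)‖ := by
        rw [e1]; exact norm_add₃_le
    _ ≤ ε / 2 + δ A * M + δ A * ∫ t, ‖Φ t‖ := by linarith [hk1.le, b2, b3]
    _ < ε := by nlinarith [hsmall, hδA]


/-! ## The hardness theorems: tightness at `b = 0` already forces RH -/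

/-- `∫ Φ² = ∫ ‖Φ‖²` (as a complex number) and it is positive. [folklore] -/
theorem integral_phi_mul_phi_eq_and_pos :
    (∫ t : ℝ, ((2 : ℂ) * LagariasMontague.Psic (2 * t)) * ((2 : ℂ) * LagariasMontague.Psic (2 * t))) =
      ((∫ t : ℝ, ‖(2 : ℂ) * LagariasMontague.Psic (2 * t)‖ ^ 2 : ℝ) : ℂ) ∧
    0 < ∫ t : ℝ, ‖(2 : ℂ) * LagariasMontague.Psic (2 * t)‖ ^ 2 := by
  constructor
  · have e : ∀ t : ℝ, ((2 : ℂ) * LagariasMontague.Psic (2 * t)) * ((2 : ℂ) * LagariasMontague.Psic (2 * t)) =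
        ((‖(2 : ℂ) * LagariasMontague.Psic (2 * t)‖ ^ 2 : ℝ) : ℂ) := by
      intro t
      rw [norm_phi, mul_pow, sq_abs]
      simp only [LagariasMontague.Psic]
      push_cast
      ring
    calc (∫ t : ℝ, ((2 : ℂ) * LagariasMontague.Psic (2 * t)) * ((2 : ℂ) * LagariasMontague.Psic (2 * t)))
        = ∫ t : ℝ, ((‖(2 : ℂ) * LagariasMontague.Psic (2 * t)‖ ^ 2 : ℝ) : ℂ) :=
          integral_congr_ae (ae_of_all _ e)
      _ = ((∫ t : ℝ, ‖(2 : ℂ) * LagariasMontague.Psic (2 * t)‖ ^ 2 : ℝ) : ℂ) := integral_ofReal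
  · obtain ⟨N₀, hN₀, hN⟩ := exists_integral_norm_sq_phiCut_ge
    refine hN₀.trans_le ((hN 2 le_rfl).trans (integral_mono
      (((isWeilTest_phiCut 2).1.continuous.norm.pow 2).integrable_of_hasCompactSupport ?_)
      ((memLp_two_iff_integrable_sq_norm Negative.integrable_phi.aestronglyMeasurable).1 Negative.memLp_phi)
      fun t => ?_))
    · have h := (isWeilTest_phiCut 2).2.norm.mul_right (f' := fun t : ℝ => ‖(2 : ℂ) * LagariasMontague.Psic (2 * t) *
        ((Literature.Analysis.Calculus.cutoff 2 t : ℝ) : ℂ)‖)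
      rw [pow_two]; exact h
    · simp only
      rw [norm_mul, Complex.norm_real, Real.norm_eq_abs,
        abs_of_nonneg (Literature.Analysis.Calculus.cutoff_nonneg 2 t), mul_pow]
      exact mul_le_of_le_one_right (sq_nonneg _) (pow_le_one₀
        (Literature.Analysis.Calculus.cutoff_nonneg 2 t) (Literature.Analysis.Calculus.cutoff_le_one 2 t))

/-- **RH FROM TIGHTNESS AT `b = 0` AND WEAK CONVERGENCE TO `Φ` (RH-free mechanism, no window
density condition).**  If along `a_k → ∞` there are ground states `u_k` and scalars `c_k` with
bounded renormalised `L¹` mass `∫‖c_k u_k‖ ≤ M` and `∫ c_k u_k g → ∫ Φ g` for every test `g`, then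
the Riemann Hypothesis holds.  (Overlaps `∫ c_k u_k φ_{a_k} → ‖Φ‖₂² > 0` by
`tendsto_integral_mul_phiCut_of_weak`; then `riemannHypothesis_of_overlap_nondegenerate`.)
This supersedes the `b₀ > 1/2` / `b₀ = 1/2` tightness thresholds of `…RHofTight`, `…RHofHalfTight`
and the geometric-window condition of `…RHofTightGeo`: the double-exponential smallness of the
Riemann-kernel probe beats the `e^{a/2}` loss of the window. [folklore] -/
theorem riemannHypothesis_of_tightZero_weakLimit {a : ℕ → ℝ} {u : ℕ → ℝ → ℂ} {c : ℕ → ℂ}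
    (ha : Tendsto a atTop atTop) (hu : ∀ k, IsWeilGroundState (a k) (u k))
    (hM : ∃ M : ℝ, ∀ k, ∫ t, ‖c k * u k t‖ ≤ M)
    (hweak : ∀ g : ℝ → ℂ, IsWeilTest g →
      Tendsto (fun k => ∫ t, c k * u k t * g t) atTop (𝓝 (∫ t, 2 * LagariasMontague.Psic (2 * t) * g t))) :
    RiemannHypothesis := by
  obtain ⟨hP, hpos⟩ := integral_phi_mul_phi_eq_and_pos
  set P : ℝ := ∫ t : ℝ, ‖(2 : ℂ) * LagariasMontague.Psic (2 * t)‖ ^ 2 with hPdef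
  have hT := tendsto_integral_mul_phiCut_of_weak ha hu hM hweak
  rw [hP] at hT
  refine riemannHypothesis_of_overlap_nondegenerate ha hu hM ⟨P / 2, by positivity, ?_⟩
  have hev := hT.norm.eventually (lt_mem_nhds (show ‖((P : ℝ) : ℂ)‖ > P / 2 by
    rw [Complex.norm_real, Real.norm_eq_abs, abs_of_pos hpos]; linarith))
  filter_upwards [hev] with k hk
  have e : c k * ∫ t, u k t * conj ((2 : ℂ) * LagariasMontague.Psic (2 * t) *
      ((Literature.Analysis.Calculus.cutoff (a k) t : ℝ) : ℂ)) =
      ∫ t, c k * u k t * ((2 : ℂ) * LagariasMontague.Psic (2 * t) *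
        ((Literature.Analysis.Calculus.cutoff (a k) t : ℝ) : ℂ)) := by
    rw [← integral_const_mul]
    refine integral_congr_ae (ae_of_all _ fun t => ?_)
    simp only [conj_phiCut]; ring
  rw [e]
  exact hk.le

/-- **C⁺ ⇒ RH.**  The line's open stub `stub_tightWeakLimit` (tightness of `c_k u_k` in every
`L¹(e^{b|t|})`, `b < 1/2`, + weak convergence to `Φ`) implies the Riemann Hypothesis — only its
`b = 0` tightness is used.  Hence the stub is RH-hard unconditionally (previous cycles: modulo
geometric windows / `T_{1/2}`). [folklore] -/
theorem riemannHypothesis_of_tightWeakLimit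
    (h : ∃ a : ℕ → ℝ, ∃ u : ℕ → ℝ → ℂ, ∃ c : ℕ → ℂ, Tendsto a atTop atTop ∧ (∀ k, c k ≠ 0) ∧
      (∀ k, IsWeilGroundState (a k) (u k)) ∧
      (∀ b : ℝ, b < 1 / 2 → ∃ M : ℝ, ∀ k, ∫ t, ‖c k * u k t‖ * Real.exp (b * |t|) ≤ M) ∧
      (∀ g : ℝ → ℂ, IsWeilTest g →
        Tendsto (fun k => ∫ t, c k * u k t * g t) atTop
          (𝓝 (∫ t, 2 * LagariasMontague.Psic (2 * t) * g t)))) :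
    RiemannHypothesis := by
  obtain ⟨a, u, c, ha, -, hu, htight, hweak⟩ := h
  obtain ⟨M, hM⟩ := htight 0 (by norm_num)
  exact riemannHypothesis_of_tightZero_weakLimit ha hu ⟨M, fun k => by simpa using hM k⟩ hweak

/-- **A witness of the CRUX with bounded renormalised `L¹` mass proves RH.**  If `(a_k, u_k, c_k)`
satisfies the clauses of `GroundStatesConvergeToXi` (ground states along `a_k → ∞`,
`c_k · weilMellin u_k → ξ` locally uniformly on the open strip) and `∫‖c_k u_k‖ ≤ M`, then RH:
weak convergence to `Φ` follows from convergence at the points `1/2 + iτ` of the strip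
(`tendsto_integral_mul_of_tendsto_criticalLine`), then `riemannHypothesis_of_tightZero_weakLimit`.
So under `¬RH` every witness of the crux has UNBOUNDED renormalised `L¹` mass. [folklore] -/
theorem riemannHypothesis_of_cruxWitness_integral_norm_le {a : ℕ → ℝ} {u : ℕ → ℝ → ℂ} {c : ℕ → ℂ}
    (ha : Tendsto a atTop atTop) (hu : ∀ k, IsWeilGroundState (a k) (u k))
    (hlim : TendstoLocallyUniformlyOn (fun k s => c k * weilMellin (u k) s) riemannXi atTop
      {s : ℂ | 0 < s.re ∧ s.re < 1})
    (hM : ∃ M : ℝ, ∀ k, ∫ t, ‖c k * u k t‖ ≤ M) : RiemannHypothesis :=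
  riemannHypothesis_of_tightZero_weakLimit ha hu hM fun _ hg =>
    tendsto_integral_mul_of_tendsto_criticalLine (fun k => (hu k).integrable) hM
      (fun τ => hlim.tendsto_at (criticalLine_mem_strip τ)) hg

/-- **The crux, restricted to witnesses of bounded renormalised `L¹` mass, implies RH** (verbatim
clauses of `GroundStatesConvergeToXi` plus `∃ M, ∀ k, ∫‖c_k u_k‖ ≤ M`). [folklore] -/
theorem riemannHypothesis_of_groundStatesConvergeToXi_integral_norm_le
    (h : ∃ a : ℕ → ℝ, ∃ u : ℕ → ℝ → ℂ, ∃ c : ℕ → ℂ, Tendsto a atTop atTop ∧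
      (∀ k, 0 < a k ∧ c k ≠ 0 ∧ MemLp (u k) 2 ∧ ∃ g : ℕ → ℝ → ℂ,
        (∀ n, IsWeilTest (g n) ∧ tsupport (g n) ⊆ Icc (-(a k)) (a k) ∧ ∫ t, ‖g n t‖ ^ 2 = (1 : ℝ)) ∧
        Tendsto (fun n => (weilQuadratic (g n)).re) atTop (𝓝 (weilGroundEnergy (a k))) ∧
        Tendsto (fun n => ∫ t, ‖g n t - u k t‖ ^ 2) atTop (𝓝 0)) ∧
      TendstoLocallyUniformlyOn (fun k s => c k * weilMellin (u k) s) riemannXi atTop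
        {s : ℂ | 0 < s.re ∧ s.re < 1} ∧
      ∃ M : ℝ, ∀ k, ∫ t, ‖c k * u k t‖ ≤ M) :
    RiemannHypothesis := by
  obtain ⟨a, u, c, ha, hk, hlim, hM⟩ := h
  exact riemannHypothesis_of_cruxWitness_integral_norm_le ha (fun k => ⟨(hk k).2.2.1, (hk k).2.2.2⟩) hlim hM

/-- **Under `¬RH`, every witness of the crux has unbounded renormalised `L¹` mass**:
`sup_k ∫‖c_k u_k‖ = ∞`. [folklore] -/
theorem integral_norm_unbounded_of_not_riemannHypothesis (hRH : ¬ RiemannHypothesis)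
    {a : ℕ → ℝ} {u : ℕ → ℝ → ℂ} {c : ℕ → ℂ}
    (ha : Tendsto a atTop atTop) (hu : ∀ k, IsWeilGroundState (a k) (u k))
    (hlim : TendstoLocallyUniformlyOn (fun k s => c k * weilMellin (u k) s) riemannXi atTop
      {s : ℂ | 0 < s.re ∧ s.re < 1}) (M : ℝ) :
    ∃ k, M < ∫ t, ‖c k * u k t‖ := by
  by_contra h
  push Not at h
  exact hRH (riemannHypothesis_of_cruxWitness_integral_norm_le ha hu hlim ⟨M, h⟩)

/-- **A non-negative witness of the crux proves RH** (no window-density condition; previous cycle: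
geometric windows).  Renormalised ground states `c_k u_k ≥ 0` a.e. are automatically tight
(`tightWeakLimit_of_nonneg_cruxWitness`), so `riemannHypothesis_of_tightWeakLimit` applies. [folklore] -/
theorem riemannHypothesis_of_nonneg_cruxWitness
    (h : ∃ a : ℕ → ℝ, ∃ u : ℕ → ℝ → ℂ, ∃ c : ℕ → ℂ, Tendsto a atTop atTop ∧ (∀ k, c k ≠ 0) ∧
      (∀ k, IsWeilGroundState (a k) (u k)) ∧
      (∀ k, ∀ᵐ t : ℝ, 0 ≤ (c k * u k t).re ∧ (c k * u k t).im = 0) ∧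
      TendstoLocallyUniformlyOn (fun k s => c k * weilMellin (u k) s) riemannXi atTop
        {s : ℂ | 0 < s.re ∧ s.re < 1}) :
    RiemannHypothesis :=
  riemannHypothesis_of_tightWeakLimit (tightWeakLimit_of_nonneg_cruxWitness h)

end Summit.RiemannHypothesis.RiemannHypothesis.Theorems.GroundStatesConvergeToXi

end
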